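import Summits.ResolutionOfSingularities.ResolutionOfSingularities.Theorems.DeltaCutStellarHypFibre

/-!
# StellarCut T15 — «GuardWild»: the BOUNDARY-VARIABLE derivation guard and the WILD fibre form
# (lens-6 «barrier-complement carving», g34; 0-weight tool of the wild coprime law `DeltaCutStellarWild`)

The tame guard of `DeltaCutStellarGuard` (T10a) / `DeltaCutStellarHypFibre` (T12) bounds the order of the reduced fibre form
`G = X_Hⁿ + ā·X^b` of a hypersurface-shape datum `hⁿ + u·m` OFF the strict transform `H'` by differentiating along the CONTACT
variable: `∂G/∂X_H = n·X_H^{n−1}` — dead when the residue characteristic divides `n` (the WILD cell `WORNCHypWild`,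
`DeltaCutStellarTame` T8).  THIS FILE supplies the guard that survives `p ∣ n`:

* `pderiv_notMem_of_X_pow_add_monomial_mem`, `algebraMap_X_pow_add_monomial_notMem_sq_of_exponent` — **the `D_j`-chart
  BOUNDARY-VARIABLE guard**: for `G = X_hⁿ + c·X^d ∈ 𝔮` with `X_h ∉ 𝔮` and a boundary index `l ≠ h` whose exponent `d l` is a
  unit of `κ`, `X_l·∂_l G = (d l)·(G − X_hⁿ)`, so `∂_l G ∈ 𝔮` would put `(d l)·X_hⁿ` in `𝔮` — impossible.  NO hypothesis on `n`:
  the guard consumes `X_h ∉ 𝔮` (the point is off `H'`) where the tame guard consumed `n ∈ κ^×`;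
* `exists_ne_isUnit_natCast_of_not_isUnit_degree` — **`p ∣ n` as a resource**: in a local ring, if `deg b` is NOT a unit and
  one coordinate `b l₁` is, then a SECOND coordinate `b l₂`, `l₂ ≠ l₁`, is (non-units form an ideal) — so on EVERY chart `j` a
  unit coordinate `l ≠ j` is available;
* `isUnit_natCast_of_cast_prime_eq_zero` — in a ring in which a prime `p` vanishes, naturals prime to `p` are units (Bezout);
* `fibreForm_notMem_sq_of_mem_maximalIdeal` (HEAVY rounds: cofactor `a ∈ 𝔪`, reduced form `X_Hⁿ`),
  `fibreForm_notMem_sq_of_exponents` (every coordinate of `b` is `0` or a unit; tame sub-case by T12's `fibreForm_notMem_sq`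
  BY NAME, wild sub-case by the two guards), packaged as `fibreForm_notMem_sq'` under the disjunction
  `a ∈ 𝔪 ∨ n ∈ R^× ∨ (∀ l, b l = 0 ∨ b l ∈ R^×)` — the `hg`-input of the near-point bound `DeltaCutStellarNearPoint` (T10c).

WILD desk inhabitant: `x² + u·z·w` in characteristic `2` (`D_z`-chart form `X_H² + ū·X_w`: `∂_{X_H} = 0`, `∂_{X_w} = ū`).
0 sorry; axioms standard. [new] [folklore] [cite: CossartPiltant2008, proof of Prop. 4.2 (a)]
-/

namespace Summit.ResolutionOfSingularities.ResolutionOfSingularities.Theorems.DeltaCutClasses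

open IsLocalRing MvPolynomial
open Literature.AlgebraicGeometry.Resolution

/-! ### §Guard — the boundary-variable derivation guard on a `D_j`-chart -/

section FibrePolynomialGuard

variable {κ : Type*} [CommRing κ] {σ : Type*}

/-- **`D_j`-chart BOUNDARY-VARIABLE guard.**  For the fibre polynomial `G = X_hⁿ + c·X^d`, a prime `𝔮 ∋ G` with `X_h ∉ 𝔮`, and
an index `l ≠ h` whose exponent `d l` is invertible in `κ`: `∂G/∂X_l ∉ 𝔮` — since `X_l·∂_l G = (d l)·c·X^d = (d l)·(G − X_hⁿ)`,
membership would force `(d l)·X_hⁿ ∈ 𝔮`.  No hypothesis on `n` (this is the guard that survives `p ∣ n`). [new] [folklore] -/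
theorem pderiv_notMem_of_X_pow_add_monomial_mem {n : ℕ} (h l : σ) (hlh : l ≠ h) (d : σ →₀ ℕ)
    (hl : IsUnit ((d l : ℕ) : κ)) (c : κ) (𝔮 : Ideal (MvPolynomial σ κ)) [𝔮.IsPrime] (hh : X h ∉ 𝔮)
    (hg : X h ^ n + monomial d c ∈ 𝔮) : pderiv l (X h ^ n + monomial d c) ∉ 𝔮 := by
  classical
  haveI := nontrivial_of_isPrime_mvPolynomial 𝔮
  have hdl : d l ≠ 0 := by
    intro h0
    rw [h0, Nat.cast_zero] at hl
    exact not_isUnit_zero hl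
  intro hmem
  have hX : X l * pderiv l (X h ^ n + monomial d c) ∈ 𝔮 := 𝔮.mul_mem_left _ hmem
  rw [map_add, Derivation.leibniz_pow, pderiv_X_of_ne hlh.symm, smul_zero, smul_zero, zero_add, pderiv_monomial, X,
    monomial_mul, add_tsub_cancel_of_le (Finsupp.single_le_iff.mpr (Nat.one_le_iff_ne_zero.mpr hdl))] at hX
  -- `hX : monomial d (1 * (c * d l)) ∈ 𝔮`, i.e. `C (d l) * monomial d c ∈ 𝔮`
  have hX' : C ((d l : ℕ) : κ) * monomial d c ∈ 𝔮 := by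
    rw [C_mul_monomial]
    convert hX using 2
    ring
  -- hence `C (d l) * X_hⁿ = C (d l) * G − C (d l) * c X^d ∈ 𝔮`
  have hC : C ((d l : ℕ) : κ) * X h ^ n ∈ 𝔮 := by
    have h3 := 𝔮.sub_mem (𝔮.mul_mem_left (C ((d l : ℕ) : κ)) hg) hX'
    rwa [mul_add, add_sub_cancel_right] at h3
  rcases Ideal.IsPrime.mem_or_mem ‹_› hC with h1 | h2
  · exact Ideal.IsPrime.ne_top ‹_› (𝔮.eq_top_of_isUnit_mem h1 (hl.map C))
  · exact hh (Ideal.IsPrime.mem_of_pow_mem ‹_› _ h2)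

/-- **Order bound on a `D_j`-chart off `H'`, boundary-variable form**: `ord_𝔮 (X_hⁿ + c·X^d) ≤ 1` at every prime `𝔮 ∌ X_h` of
`κ[X]`, as soon as one exponent `d l`, `l ≠ h`, is invertible in `κ` — in any localization `L` at `𝔮`; no hypothesis on `n`.
[new] [folklore] -/
theorem algebraMap_X_pow_add_monomial_notMem_sq_of_exponent {n : ℕ} (h l : σ) (hlh : l ≠ h) (d : σ →₀ ℕ)
    (hl : IsUnit ((d l : ℕ) : κ)) (c : κ) (𝔮 : Ideal (MvPolynomial σ κ)) [𝔮.IsPrime] (hh : X h ∉ 𝔮) (L : Type*)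
    [CommRing L] [IsLocalRing L] [Algebra (MvPolynomial σ κ) L] [IsLocalization.AtPrime L 𝔮] :
    algebraMap (MvPolynomial σ κ) L (X h ^ n + monomial d c) ∉ maximalIdeal L ^ 2 := by
  by_cases hg : X h ^ n + monomial d c ∈ 𝔮
  · exact algebraMap_notMem_maximalIdeal_sq_of_derivation_apply_notMem (pderiv l) 𝔮 L
      (pderiv_notMem_of_X_pow_add_monomial_mem h l hlh d hl c 𝔮 hh hg)
  · exact algebraMap_notMem_maximalIdeal_sq_of_notMem 𝔮 L hg

end FibrePolynomialGuard

/-! ### §Units — the second unit coordinate; naturals prime to the characteristic -/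

section Units

/-- **`p ∣ n` as a resource.**  In a local ring: if the degree of an exponent vector `b` is NOT a unit while one coordinate
`b l₁` is, then a SECOND coordinate `b l₂`, `l₂ ≠ l₁`, is a unit (the non-units form the maximal ideal, and a unit plus a
non-unit is a unit). [new] [folklore] -/
theorem exists_ne_isUnit_natCast_of_not_isUnit_degree {R : Type*} [CommRing R] [IsLocalRing R] {k : ℕ} (b : Fin k →₀ ℕ)
    (hdeg : ¬ IsUnit ((b.degree : ℕ) : R)) {l₁ : Fin k} (h₁ : IsUnit ((b l₁ : ℕ) : R)) :
    ∃ l₂, l₂ ≠ l₁ ∧ IsUnit ((b l₂ : ℕ) : R) := by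
  classical
  by_contra hne
  push Not at hne
  have hs : ∑ l ∈ Finset.univ.erase l₁, ((b l : ℕ) : R) ∈ maximalIdeal R :=
    Ideal.sum_mem _ fun l hl => (mem_maximalIdeal _).mpr (mem_nonunits_iff.mpr (hne l (Finset.ne_of_mem_erase hl)))
  refine hdeg ?_
  rw [Finsupp.degree_eq_sum, Nat.cast_sum, ← Finset.add_sum_erase _ _ (Finset.mem_univ l₁)]
  by_contra hu
  have hmem : ((b l₁ : ℕ) : R) + ∑ l ∈ Finset.univ.erase l₁, ((b l : ℕ) : R) ∈ maximalIdeal R :=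
    (mem_maximalIdeal _).mpr (mem_nonunits_iff.mpr hu)
  have h₁' : ((b l₁ : ℕ) : R) ∈ maximalIdeal R := by
    have h := Ideal.sub_mem _ hmem hs
    rwa [add_sub_cancel_right] at h
  exact (mem_nonunits_iff.mp ((mem_maximalIdeal _).mp h₁')) h₁

/-- **In a ring in which a prime `p` vanishes, every natural number prime to `p` is a unit** (Bezout: `a·m + b·p = 1`).
[folklore] -/
theorem isUnit_natCast_of_cast_prime_eq_zero {R : Type*} [CommRing R] {p : ℕ} (hp : p.Prime) (hpR : (p : R) = 0) {m : ℕ}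
    (hm : ¬ p ∣ m) : IsUnit ((m : ℕ) : R) := by
  obtain ⟨a, b, hab⟩ := ((hp.coprime_iff_not_dvd.mpr hm).symm).isCoprime
  have h := congrArg (Int.cast : ℤ → R) hab
  push_cast at h
  rw [hpR, mul_zero, add_zero, mul_comm] at h
  exact isUnit_iff_exists_inv.mpr ⟨_, h⟩

end Units

/-! ### §Fibre — the reduced dehomogenised fibre form has order `≤ 1` on every chart: HEAVY, TAME and WILD -/

section Fibre

variable {R : Type*} [CommRing R] [IsLocalRing R] {k n : ℕ}

set_option maxHeartbeats 800000 in
/-- **HEAVY rounds** (`a ∈ 𝔪`): the reduced dehomogenised form of `X_{l_H}ⁿ + a·X^b` is `X_{l_H}ⁿ` (resp. `1` on the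
`H`-chart), which lies in no prime avoiding `X_{l_H}` — order `0` there. [new] [folklore] -/
theorem fibreForm_notMem_sq_of_mem_maximalIdeal (lH : Fin k) (b : Fin k →₀ ℕ) {a : R} (ha : a ∈ maximalIdeal R) (j : Fin k)
    (𝔮 : Ideal (MvPolynomial {l : Fin k // l ≠ j} (R ⧸ maximalIdeal R))) [𝔮.IsPrime]
    (h𝔮 : ∀ l : {l : Fin k // l ≠ j}, l.1 ∈ ({lH} : Set (Fin k)) →
      (MvPolynomial.X l : MvPolynomial {l : Fin k // l ≠ j} (R ⧸ maximalIdeal R)) ∉ 𝔮) :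
    algebraMap _ (Localization.AtPrime 𝔮) (MvPolynomial.map (Ideal.Quotient.mk (maximalIdeal R))
      (dehomogenize j (MvPolynomial.X lH ^ n + MvPolynomial.monomial b a))) ∉ maximalIdeal (Localization.AtPrime 𝔮) ^ 2 := by
  classical
  have hF : MvPolynomial.map (Ideal.Quotient.mk (maximalIdeal R))
      (dehomogenize j (MvPolynomial.X lH ^ n + MvPolynomial.monomial b a)) = killVar j lH ^ n := by
    rw [map_dehomogenize, map_add, map_pow, MvPolynomial.map_X, MvPolynomial.map_monomial,
      Ideal.Quotient.eq_zero_iff_mem.mpr ha, map_zero, add_zero, map_pow, dehomogenize_X]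
  rw [hF]
  refine algebraMap_notMem_maximalIdeal_sq_of_notMem 𝔮 (Localization.AtPrime 𝔮) (fun hmem => ?_)
  by_cases hj : lH = j
  · subst hj
    rw [killVar_self, one_pow] at hmem
    exact Ideal.IsPrime.ne_top ‹_› ((Ideal.eq_top_iff_one 𝔮).mpr hmem)
  · rw [killVar_of_ne j hj] at hmem
    exact h𝔮 ⟨lH, hj⟩ (Set.mem_singleton lH) (Ideal.IsPrime.mem_of_pow_mem ‹_› _ hmem)

set_option maxHeartbeats 800000 in
/-- **TAME or WILD tight rounds** (every coordinate of `b` is `0` or a unit of `R`, `deg b = n ≠ 0`, `b l_H = 0`): the reduced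
dehomogenised form of `X_{l_H}ⁿ + a·X^b` has order `≤ 1` at every prime avoiding `X_{l_H}`, on every chart `j`.  If `n ∈ R^×`
this is T12's `fibreForm_notMem_sq` (by name).  Otherwise a positive coordinate `b l₁` is a unit and — `deg b` NOT being one — so
is a second `b l₂` (`exists_ne_isUnit_natCast_of_not_isUnit_degree`); one of `l₁, l₂` differs from `j`: on the `H`-chart T10a's
guard `algebraMap_one_add_monomial_notMem_sq`, on a `D_j`-chart the boundary-variable guard
`algebraMap_X_pow_add_monomial_notMem_sq_of_exponent`. [new] [cite: CossartPiltant2008, proof of Prop. 4.2 (a)] -/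
theorem fibreForm_notMem_sq_of_exponents (hn : n ≠ 0) (lH : Fin k) (b : Fin k →₀ ℕ) (hblH : b lH = 0) (hbn : b.degree = n)
    (hb : ∀ l, b l = 0 ∨ IsUnit ((b l : ℕ) : R)) (a : R) (j : Fin k)
    (𝔮 : Ideal (MvPolynomial {l : Fin k // l ≠ j} (R ⧸ maximalIdeal R))) [𝔮.IsPrime]
    (h𝔮 : ∀ l : {l : Fin k // l ≠ j}, l.1 ∈ ({lH} : Set (Fin k)) →
      (MvPolynomial.X l : MvPolynomial {l : Fin k // l ≠ j} (R ⧸ maximalIdeal R)) ∉ 𝔮) :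
    algebraMap _ (Localization.AtPrime 𝔮) (MvPolynomial.map (Ideal.Quotient.mk (maximalIdeal R))
      (dehomogenize j (MvPolynomial.X lH ^ n + MvPolynomial.monomial b a))) ∉ maximalIdeal (Localization.AtPrime 𝔮) ^ 2 := by
  classical
  by_cases hnu : IsUnit ((n : ℕ) : R)
  · exact fibreForm_notMem_sq hnu lH b hblH hbn a j 𝔮 h𝔮
  -- a positive coordinate `l₁` (a unit), then a second unit coordinate `l₂ ≠ l₁`
  obtain ⟨l₁, hl₁⟩ : ∃ l, b l ≠ 0 := by
    by_contra h0
    push Not at h0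
    apply hn
    rw [← hbn, Finsupp.degree_eq_sum]
    exact Finset.sum_eq_zero fun l _ => h0 l
  have hu₁ : IsUnit ((b l₁ : ℕ) : R) := (hb l₁).resolve_left hl₁
  obtain ⟨l₂, hl₂₁, hu₂⟩ := exists_ne_isUnit_natCast_of_not_isUnit_degree b (by rwa [hbn]) hu₁
  have hl₂ : b l₂ ≠ 0 := fun h0 => by
    rw [h0, Nat.cast_zero] at hu₂
    exact not_isUnit_zero hu₂
  -- one of them differs from the chart index `j`
  obtain ⟨l, hlj, hl0, hu⟩ : ∃ l, l ≠ j ∧ b l ≠ 0 ∧ IsUnit ((b l : ℕ) : R) := by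
    by_cases h : l₁ = j
    · exact ⟨l₂, fun h' => hl₂₁ (h'.trans h.symm), hl₂, hu₂⟩
    · exact ⟨l₁, h, hl₁, hu₁⟩
  have hllH : l ≠ lH := fun h => hl0 (h ▸ hblH)
  have huκ : IsUnit ((b l : ℕ) : R ⧸ maximalIdeal R) := by
    simpa only [map_natCast] using hu.map (Ideal.Quotient.mk (maximalIdeal R))
  have hF : MvPolynomial.map (Ideal.Quotient.mk (maximalIdeal R))
      (dehomogenize j (MvPolynomial.X lH ^ n + MvPolynomial.monomial b a)) = killVar j lH ^ n +
        MvPolynomial.monomial (b.subtypeDomain fun l => l ≠ j) (Ideal.Quotient.mk (maximalIdeal R) a) := by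
    rw [map_dehomogenize, map_add, map_pow, MvPolynomial.map_X, MvPolynomial.map_monomial, map_add, map_pow, dehomogenize_X,
      dehomogenize_monomial]
  rw [hF]
  by_cases hj : lH = j
  · -- the `H`-chart: `1 + ā X^b`, guard along `X_l`
    subst hj
    rw [killVar_self, one_pow]
    exact algebraMap_one_add_monomial_notMem_sq (b.subtypeDomain fun l => l ≠ lH) (Ideal.Quotient.mk (maximalIdeal R) a)
      ⟨l, hlj⟩ (by rwa [Finsupp.subtypeDomain_apply]) 𝔮 (Localization.AtPrime 𝔮)
  · -- a `D_j`-chart off `V(H')`: `X_{l_H}ⁿ + ā X^b`, `X_{l_H} ∉ 𝔮`, guard along the BOUNDARY variable `X_l`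
    rw [killVar_of_ne j hj]
    exact algebraMap_X_pow_add_monomial_notMem_sq_of_exponent ⟨lH, hj⟩ ⟨l, hlj⟩
      (fun h => hllH (congrArg Subtype.val h)) (b.subtypeDomain fun l => l ≠ j)
      (by rwa [Finsupp.subtypeDomain_apply]) (Ideal.Quotient.mk (maximalIdeal R) a) 𝔮
      (h𝔮 ⟨lH, hj⟩ (Set.mem_singleton lH)) (Localization.AtPrime 𝔮)

/-- **THE FIBRE GUARD, HEAVY ∨ TAME ∨ WILD** — the `hg`-input of the near-point bound (T10c) for the fibre form
`X_{l_H}ⁿ + a·X^b` under the SAFE disjunction `a ∈ 𝔪 ∨ n ∈ R^× ∨ (∀ l, b l = 0 ∨ b l ∈ R^×)`. [new]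
[cite: CossartPiltant2008, proof of Prop. 4.2 (a)] -/
theorem fibreForm_notMem_sq' (hn : n ≠ 0) (lH : Fin k) (b : Fin k →₀ ℕ) (hblH : b lH = 0) (hbn : b.degree = n) (a : R)
    (hsafe : a ∈ maximalIdeal R ∨ IsUnit ((n : ℕ) : R) ∨ ∀ l, b l = 0 ∨ IsUnit ((b l : ℕ) : R)) (j : Fin k)
    (𝔮 : Ideal (MvPolynomial {l : Fin k // l ≠ j} (R ⧸ maximalIdeal R))) [𝔮.IsPrime]
    (h𝔮 : ∀ l : {l : Fin k // l ≠ j}, l.1 ∈ ({lH} : Set (Fin k)) →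
      (MvPolynomial.X l : MvPolynomial {l : Fin k // l ≠ j} (R ⧸ maximalIdeal R)) ∉ 𝔮) :
    algebraMap _ (Localization.AtPrime 𝔮) (MvPolynomial.map (Ideal.Quotient.mk (maximalIdeal R))
      (dehomogenize j (MvPolynomial.X lH ^ n + MvPolynomial.monomial b a))) ∉ maximalIdeal (Localization.AtPrime 𝔮) ^ 2 := by
  rcases hsafe with ha | hnu | hb
  · exact fibreForm_notMem_sq_of_mem_maximalIdeal lH b ha j 𝔮 h𝔮
  · exact fibreForm_notMem_sq hnu lH b hblH hbn a j 𝔮 h𝔮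
  · exact fibreForm_notMem_sq_of_exponents hn lH b hblH hbn hb a j 𝔮 h𝔮

end Fibre

end Summit.ResolutionOfSingularities.ResolutionOfSingularities.Theorems.DeltaCutClasses
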